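import Summits.Ventures.HodgeRepro2.T5HeckeDoubleCoset

/-!
# Hecke operators of elements normalising `K`: `T_g = π(g)` on `π^K`

Kernel annex of the Tier-5 record (blind lane).  For `g` in the normaliser of `K` (in particular
for `g` central) the double coset `K g K` is the single coset `g K`, so the operator
`T_g = 1_{KgK}` of `T5HeckeDoubleCoset` acts on `π^K` simply by `π(g)`:

* `orbit_eq_singleton_of_mem_normalizer` — `K g K / K = {gK}` for `g ∈ N_G(K)`;
* `apply_mem_invariants_of_mem_normalizer` — `π(g)` preserves `π^K` for `g ∈ N_G(K)`;
* `heckeSMul_doubleCosetOp_of_mem_normalizer` — `T_g • v = π(g) v` on `π^K`;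
* `heckeSMul_doubleCosetOp_of_mem_center` — the central case, and
  `heckeSMul_doubleCosetOp_of_mem_center_eq_smul` — if `π(z)` is the scalar `ω(z)` (the central
  character), `T_z • v = ω(z) • v`: the Hecke eigenvalue at a central `z` is the central character.

What stays prose: Schur's lemma for the specific irreducible admissible `π` (that `π(z)` IS a
scalar — here a hypothesis); the printed theorems.
-/

namespace Summit.Ventures.HodgeRepro2.T5HeckeNormalizer

open T5HeckePermutationModule T5HeckeDoubleCoset LevelPositivity

variable {G : Type*} [Group G] {k : Type*} [Field k] {K : Subgroup G}

/-- For `g ∈ N_G(K)` the `K`-orbit of `gK` is `{gK}`: `κ g K = g (g⁻¹ κ g) K = g K`. -/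
theorem orbit_eq_singleton_of_mem_normalizer {g : G} (hg : g ∈ Subgroup.normalizer (K : Set G)) :
    MulAction.orbit K ((g : G) : G ⧸ K) = {((g : G) : G ⧸ K)} := by
  ext x
  constructor
  · rintro ⟨⟨κ, hκ⟩, rfl⟩
    change ((κ * g : G) : G ⧸ K) ∈ {((g : G) : G ⧸ K)}
    rw [Set.mem_singleton_iff, QuotientGroup.eq]
    have : (κ * g)⁻¹ * g = g⁻¹ * κ⁻¹ * g := by group
    rw [this]
    exact (Subgroup.mem_normalizer_iff''.1 hg κ⁻¹).1 (K.inv_mem hκ)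
  · intro hx
    rw [Set.mem_singleton_iff] at hx
    rw [hx]
    exact MulAction.mem_orbit_self _

/-- `K g K / K` is finite for `g ∈ N_G(K)`. -/
theorem finite_orbit_of_mem_normalizer {g : G} (hg : g ∈ Subgroup.normalizer (K : Set G)) :
    Finite (MulAction.orbit K ((g : G) : G ⧸ K)) := by
  rw [orbit_eq_singleton_of_mem_normalizer hg]
  infer_instance

variable {V : Type*} [AddCommGroup V] [Module k V] (ρ : Representation k G V)

/-- `π(g)` preserves `π^K` for `g ∈ N_G(K)`. -/
theorem apply_mem_invariants_of_mem_normalizer {g : G} (hg : g ∈ Subgroup.normalizer (K : Set G)) {v : V}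
    (hv : v ∈ invariants ρ K) : ρ g v ∈ invariants ρ K := by
  rw [mem_invariants_iff] at hv ⊢
  intro κ hκ
  have hκ' : g⁻¹ * κ * g ∈ K := (Subgroup.mem_normalizer_iff''.1 hg κ).1 hκ
  have : ρ κ (ρ g v) = ρ g (ρ (g⁻¹ * κ * g) v) := by
    rw [← Module.End.mul_apply, ← map_mul, ← Module.End.mul_apply, ← map_mul]
    congr 2
    group
  rw [this, hv _ hκ']

/-- **`T_g • v = π(g) v` on `π^K` for `g ∈ N_G(K)`** (the double coset is the single coset `gK`). -/
theorem heckeSMul_doubleCosetOp_of_mem_normalizer {g : G} (hg : g ∈ Subgroup.normalizer (K : Set G))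
    [Finite (MulAction.orbit K ((g : G) : G ⧸ K))] (v : invariants ρ K) :
    (heckeSMul ρ (doubleCosetOp k K g) v : V) = ρ g (v : V) := by
  rw [heckeSMul_doubleCosetOp, orbit_eq_singleton_of_mem_normalizer hg, finsum_mem_singleton,
    orbitMap_mk]

/-- The central case: `T_z • v = π(z) v` on `π^K` for `z ∈ Z(G)`. -/
theorem heckeSMul_doubleCosetOp_of_mem_center {z : G} (hz : z ∈ Subgroup.center G)
    [Finite (MulAction.orbit K ((z : G) : G ⧸ K))] (v : invariants ρ K) :
    (heckeSMul ρ (doubleCosetOp k K z) v : V) = ρ z (v : V) :=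
  heckeSMul_doubleCosetOp_of_mem_normalizer ρ (Subgroup.center_le_normalizer (K : Set G) hz) v

/-- **The Hecke eigenvalue at a central element is the central character**: if `π(z) = ω(z) • id`
then `T_z • v = ω(z) • v` on `π^K`. -/
theorem heckeSMul_doubleCosetOp_of_mem_center_eq_smul {z : G} (hz : z ∈ Subgroup.center G)
    [Finite (MulAction.orbit K ((z : G) : G ⧸ K))] {ω : k} (hω : ∀ x : V, ρ z x = ω • x)
    (v : invariants ρ K) : (heckeSMul ρ (doubleCosetOp k K z) v : V) = ω • (v : V) := by
  rw [heckeSMul_doubleCosetOp_of_mem_center ρ hz v, hω]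

end Summit.Ventures.HodgeRepro2.T5HeckeNormalizer
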